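import Summits.MatrixMultiplication.OmegaCensus.STPPKernelListerDataZ61
import Summits.MatrixMultiplication.OmegaCensus.STPPKernelListerSplit


/-!
# ω-census (abelian STPP census): kernel lister rows for `ℤ₆₁` (split form), file 21 of 74 (kernel computation)

HONEST FRAMING (pub-omega census; verbatim): lottery ticket; floor = certified bounds/negative ranges.
Census STRUCTURE (seat pub-omega-stpp-2 gen 29, 2026-08-29), family (b2).  One chunk of the root computation of the kernel lister at `n = 61` in SPLIT
form (`KLister.scanFirstSel2C`, `STPPKernelListerSplit.lean`): light first blocks (part 7 of 8: 25 shapes), second blocks unrestricted.  Twin estimate ≈ 2727 calls ≈ 1 s of kernel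
(HOME `pub-omega-stpp-2-g29/code/split_plan.py`, `klister_lean.py`).  Assembled in `STPPKernelListerCapstoneZ61.lean`.  Pure finite computation; nothing here is
progress on `ω`.
-/

namespace Summit.MatrixMultiplication.OmegaCensus.KLister

/-- First blocks of this file. [folklore] -/
def sel1Z61S21P7 : List Shape := [(2, 5, 1), (5, 1, 2), (5, 2, 1), (10, 1, 1), (1, 1, 9), (1, 3, 3), (1, 9, 1), (3, 1, 3), (3, 3, 1), (9, 1, 1), (1, 1, 8), (1, 2, 4), (1, 4, 2), (1, 8, 1), (2, 1, 4), (2, 4, 1), (4, 1, 2), (4, 2, 1), (8, 1, 1), (1, 1, 7), (1, 7, 1), (7, 1, 1), (1, 1, 6), (1, 2, 3), (1, 3, 2)]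


set_option maxRecDepth 32768 in
set_option maxHeartbeats 4000000 in
/-- Rows of the kernel lister at `61` (split form) for this file's selections. [folklore] -/
theorem scanSel_Z61_S21P7 :
    scanFirstSel2C 61 deadZ61 (fun s => sel1Z61S21P7.contains s) (fun _ => true) chunksZ61 = true := by
  decide +kernel

end Summit.MatrixMultiplication.OmegaCensus.KLister
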